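import Summits.AnomalousDissipation.AnomalousDissipation.Theorems.SolenoidalFractalHomogenisationLagrangianCarrierConstructionTowerStepA
import Summits.AnomalousDissipation.AnomalousDissipation.Theorems.SolenoidalFractalHomogenisationLagrangianCarrierConstructionLevelField
import Literature.Analysis.FluidPDE.AdditiveNoiseFlowDerivative
import HarnessLib

/-!
# K3L `LagrangianCarrierConstruction` (stmt-AnomalousDissipation-24913), line `birth`, stub `stub_flowsL`:
# unit Jacobians along the Lagrangian tower — Liouville (helper; `--supports stmt-AnomalousDissipation-24913`)

Summits-side helper file (everything proved; no definitions, no named facts). Towards clause (F2c) of `LevelRegular` (the flow maps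
preserve the volume of the torus): the Jacobian determinant of every map of the Lagrangian tower is `1`.
* Determinant `1` is preserved by `trans`, by inverses, by the accumulation recursion of the window maps and by the window formula
  (chain rule + multiplicativity of `det`);
* **Liouville for the Eulerian levels**: the evolution maps of the lifted level field `(t, z) ↦ level m t (proj z)` have Jacobian
  determinant `1` for ALL pairs of times — on each one-sided time slab the field is jointly smooth and divergence free, so the tree's
  variational equation / Jacobi formula (`Literature.Analysis.FluidPDE.Torus.exists_hasFDerivAt_noisyFlow`, `det_linearization_eq_one`,
  with zero noise) gives `det = 1` there, and the slabs are chained by the group law.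
The descent to `MeasurePreserving` on the torus is `Torus.measurePreserving_of_equivariant_det_one` (AdditiveNoiseMeasurePreserving), applied
at assembly. NOT a proof of anomalous dissipation (F-D1 is a frontier formal rung).
-/

set_option linter.dupNamespace false

noncomputable section

namespace Summit.AnomalousDissipation.AnomalousDissipation.Theorems.SolenoidalFractalHomogenisation.LagrangianCarrierConstruction

open Set Function Filter Topology Metric
open scoped NNReal ContDiff
open Literature.Analysis Literature.Analysis.ODE Literature.Analysis.FunctionSpaces Literature.Analysis.FunctionSpaces.Torus
open Literature.Analysis.FluidPDE Literature.Analysis.FluidPDE.LatticeShear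

section DetAlgebra

variable {V : Type*} [NormedAddCommGroup V] [NormedSpace ℝ V]

/-- Determinant of a composition of derivatives. [folklore] -/
theorem det_fderiv_comp {f g : V → V} (hf : ContDiff ℝ 1 f) (hg : ContDiff ℝ 1 g) (z : V) :
    (fderiv ℝ (fun y => f (g y)) z).det = (fderiv ℝ f (g z)).det * (fderiv ℝ g z).det := by
  have e : fderiv ℝ (fun y => f (g y)) z = (fderiv ℝ f (g z)).comp (fderiv ℝ g z) :=
    fderiv_comp z ((hf.differentiable (by simp)) _) ((hg.differentiable (by simp)) _)
  rw [e]
  show LinearMap.det ((fderiv ℝ f (g z) : V →ₗ[ℝ] V).comp (fderiv ℝ g z : V →ₗ[ℝ] V)) = _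
  rw [LinearMap.det_comp]

/-- `det = 1` is preserved by `trans` (with the `C¹` bookkeeping). [folklore] -/
theorem det_trans {e f : V ≃ V} (he : ContDiff ℝ 1 e ∧ ContDiff ℝ 1 e.symm) (hf : ContDiff ℝ 1 f ∧ ContDiff ℝ 1 f.symm)
    (hde : (∀ z, (fderiv ℝ e z).det = 1) ∧ ∀ z, (fderiv ℝ e.symm z).det = 1)
    (hdf : (∀ z, (fderiv ℝ f z).det = 1) ∧ ∀ z, (fderiv ℝ f.symm z).det = 1) :
    (∀ z, (fderiv ℝ (e.trans f) z).det = 1) ∧ ∀ z, (fderiv ℝ (e.trans f).symm z).det = 1 := by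
  constructor
  · intro z
    have h : ⇑(e.trans f) = fun y => f (e y) := funext fun y => by simp
    rw [h, det_fderiv_comp hf.1 he.1, hdf.1, hde.1, mul_one]
  · intro z
    have h : ⇑(e.trans f).symm = fun y => e.symm (f.symm y) := funext fun y => by simp
    rw [h, det_fderiv_comp he.2 hf.2, hde.2, hdf.2, mul_one]

/-- `det = 1` for inverses comes for free. [folklore] -/
theorem det_symm {e : V ≃ V} (hde : (∀ z, (fderiv ℝ e z).det = 1) ∧ ∀ z, (fderiv ℝ e.symm z).det = 1) :
    (∀ z, (fderiv ℝ e.symm z).det = 1) ∧ ∀ z, (fderiv ℝ e.symm.symm z).det = 1 := by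
  rw [Equiv.symm_symm]; exact ⟨hde.2, hde.1⟩

/-- **The accumulated window maps have unit Jacobian** when the transition maps do. [folklore] -/
theorem det_chain (C M : ℤ → V ≃ V) (hC0 : C 0 = Equiv.refl _) (hC : ∀ j : ℤ, C (j + 1) = (C j).trans (M j))
    (hM : ∀ j : ℤ, ContDiff ℝ 1 (M j) ∧ ContDiff ℝ 1 (M j).symm)
    (hdM : ∀ j : ℤ, (∀ z, (fderiv ℝ (M j) z).det = 1) ∧ ∀ z, (fderiv ℝ (M j).symm z).det = 1) :
    ∀ j : ℤ, (∀ z, (fderiv ℝ (C j) z).det = 1) ∧ ∀ z, (fderiv ℝ (C j).symm z).det = 1 := by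
  have h := chain_induction C M (P := fun e => (ContDiff ℝ 1 e ∧ ContDiff ℝ 1 e.symm) ∧
      ((∀ z, (fderiv ℝ e z).det = 1) ∧ ∀ z, (fderiv ℝ e.symm z).det = 1)) hC0 hC
    (by
      refine ⟨by rw [Equiv.refl_symm]; exact ⟨contDiff_id, contDiff_id⟩, ?_, ?_⟩ <;> intro z <;>
        simp [ContinuousLinearMap.det])
    (fun j e he => ⟨contDiff_trans he.1 (hM j), det_trans he.1 (hM j) he.2 (hdM j)⟩)
    (fun j e he => ⟨contDiff_trans he.1 (contDiff_symm (hM j)), det_trans he.1 (contDiff_symm (hM j)) he.2 (det_symm (hdM j))⟩)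
  exact fun j => (h j).2

/-- **The window formula has unit Jacobian** when its four factors do. [folklore] -/
theorem det_window_formula (A : ℝ → V ≃ V) (Z : ℝ → ℝ → V ≃ V) (C : V ≃ V)
    (hA : ∀ t, ContDiff ℝ 1 (A t) ∧ ContDiff ℝ 1 (A t).symm) (hZ : ∀ t s, ContDiff ℝ 1 (Z t s) ∧ ContDiff ℝ 1 (Z t s).symm)
    (hC : ContDiff ℝ 1 C ∧ ContDiff ℝ 1 C.symm)
    (hdA : ∀ t, (∀ z, (fderiv ℝ (A t) z).det = 1) ∧ ∀ z, (fderiv ℝ (A t).symm z).det = 1)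
    (hdZ : ∀ t s, (∀ z, (fderiv ℝ (Z t s) z).det = 1) ∧ ∀ z, (fderiv ℝ (Z t s).symm z).det = 1)
    (hdC : (∀ z, (fderiv ℝ C z).det = 1) ∧ ∀ z, (fderiv ℝ C.symm z).det = 1) (t s : ℝ) :
    (∀ z, (fderiv ℝ (C.trans ((Z t s).trans ((A s).symm.trans (A t)))) z).det = 1) ∧
      ∀ z, (fderiv ℝ (C.trans ((Z t s).trans ((A s).symm.trans (A t)))).symm z).det = 1 :=
  det_trans hC (contDiff_trans (hZ t s) (contDiff_trans (contDiff_symm (hA s)) (hA t))) hdC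
    (det_trans (hZ t s) (contDiff_trans (contDiff_symm (hA s)) (hA t)) (hdZ t s)
      (det_trans (contDiff_symm (hA s)) (hA t) (det_symm (hdA s)) (hdA t)))

end DetAlgebra

section Eulerian

variable {d : Type*} [Fintype d] [DecidableEq d]

/-- **Liouville on a smooth slab**: for a torus field `u`, jointly smooth and divergence free on `[a, b]`, whose lift satisfies the
Cauchy–Lipschitz hypotheses on `ℝ`, the evolution maps between times of `[a, b]` have Jacobian determinant `1` (the derivative in the
initial point solves the variational equation — `Torus.exists_hasFDerivAt_noisyFlow` with zero noise — and Jacobi's formula gives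
`(det)' = det · div u = 0`, `Torus.det_linearization_eq_one`). [folklore] -/
theorem det_fderiv_evolutionMap_slab {u : ℝ → UnitAddTorus d → EuclideanSpace ℝ d} {a b : ℝ} (hab : a < b)
    (hu : IsSmoothSpaceTimeOn (Icc a b) u) (hdiv : ∀ s ∈ Icc a b, IsDivFree (u s))
    (hv : IsUniformlyLipschitzOn (fun t (z : EuclideanSpace ℝ d) => u t (proj z)) univ)
    {t₀ τ : ℝ} (ht₀ : t₀ ∈ Icc a b) (hτ : τ ∈ Icc a b) (y : EuclideanSpace ℝ d) :
    (fderiv ℝ (evolutionMap (fun t (z : EuclideanSpace ℝ d) => u t (proj z)) t₀ τ) y).det = 1 := by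
  have hY0 : ∀ y : EuclideanSpace ℝ d, evolutionMap (fun t (z : EuclideanSpace ℝ d) => u t (proj z)) t₀ t₀ y = y :=
    fun y => evolutionMap_self _ _ _
  have hY : ∀ y : EuclideanSpace ℝ d, ∀ s ∈ Icc a b,
      HasDerivWithinAt (fun s => evolutionMap (fun t (z : EuclideanSpace ℝ d) => u t (proj z)) t₀ s y)
        (Torus.lift (u s) (evolutionMap (fun t (z : EuclideanSpace ℝ d) => u t (proj z)) t₀ s y + (fun _ : ℝ =>
          (0 : EuclideanSpace ℝ d)) s)) (Icc a b) s := by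
    intro y s _
    have h := (hasDerivAt_evolutionMap_univ hv t₀ s y).hasDerivWithinAt (s := Icc a b)
    simpa [Torus.lift_apply] using h
  obtain ⟨J, hJ0, hJ, hJd⟩ := Literature.Analysis.FluidPDE.Torus.exists_hasFDerivAt_noisyFlow hab hu
    (c := fun _ => (0 : EuclideanSpace ℝ d)) continuousOn_const ht₀ hY0 hY y
  rw [(hJd τ hτ).fderiv]
  exact Literature.Analysis.FluidPDE.Torus.det_linearization_eq_one hdiv hu ht₀ hJ0 hJ hτ

/-- **Liouville for all pairs of times**: if around every time the field is jointly smooth on one-sided slabs and it is divergence free at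
every time, then every evolution map has Jacobian determinant `1` (chain the slabs by the group law). [folklore] -/
theorem det_fderiv_evolutionMap_of_local {u : ℝ → UnitAddTorus d → EuclideanSpace ℝ d}
    (hloc : ∀ r : ℝ, ∃ ε > 0, IsSmoothSpaceTimeOn (Icc r (r + ε)) u ∧ IsSmoothSpaceTimeOn (Icc (r - ε) r) u)
    (hdiv : ∀ s, IsDivFree (u s)) (hv : IsUniformlyLipschitzOn (fun t (z : EuclideanSpace ℝ d) => u t (proj z)) univ)
    (s t : ℝ) (y : EuclideanSpace ℝ d) :
    (fderiv ℝ (evolutionMap (fun t (z : EuclideanSpace ℝ d) => u t (proj z)) s t) y).det = 1 := by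
  -- the local smoothness hypothesis in the `C^1` form used by the flow calculus
  have hloc1 : ∀ r : ℝ, ∃ ε > 0, ContDiffOn ℝ 1 (uncurry fun t (z : EuclideanSpace ℝ d) => u t (proj z)) (Icc r (r + ε) ×ˢ univ) ∧
      ContDiffOn ℝ 1 (uncurry fun t (z : EuclideanSpace ℝ d) => u t (proj z)) (Icc (r - ε) r ×ˢ univ) := by
    intro r
    obtain ⟨ε, hε, h1, h2⟩ := hloc r
    exact ⟨ε, hε, h1.of_le (by exact_mod_cast le_top), h2.of_le (by exact_mod_cast le_top)⟩
  revert y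
  refine forall_of_chain_local (P := fun s t => ∀ y : EuclideanSpace ℝ d,
    (fderiv ℝ (evolutionMap (fun t (z : EuclideanSpace ℝ d) => u t (proj z)) s t) y).det = 1) ?_ ?_ ?_ s t
  · intro s y
    have e : evolutionMap (fun t (z : EuclideanSpace ℝ d) => u t (proj z)) s s = id := funext fun z => evolutionMap_self _ _ _
    rw [e, fderiv_id]
    simp [ContinuousLinearMap.det]
  · intro r s t hrs hst y
    have e : evolutionMap (fun t (z : EuclideanSpace ℝ d) => u t (proj z)) r t =
        fun z => evolutionMap (fun t (z : EuclideanSpace ℝ d) => u t (proj z)) s t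
          (evolutionMap (fun t (z : EuclideanSpace ℝ d) => u t (proj z)) r s z) :=
      funext fun z => (evolutionMap_trans_univ hv r s t z).symm
    rw [e, det_fderiv_comp (contDiff_evolutionMap_of_local hv le_rfl hloc1 s t)
      (contDiff_evolutionMap_of_local hv le_rfl hloc1 r s), hst, hrs, mul_one]
  · intro r
    obtain ⟨ε, hε, h1, h2⟩ := hloc r
    refine ⟨ε, hε, fun t ht => ?_⟩
    rw [Real.dist_eq, abs_lt] at ht
    rcases le_or_gt r t with hrt | htr
    · have ht' : t ∈ Icc r (r + ε) := ⟨hrt, by linarith [ht.2]⟩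
      have hr' : r ∈ Icc r (r + ε) := ⟨le_rfl, by linarith⟩
      exact ⟨fun y => det_fderiv_evolutionMap_slab (by linarith) h1 (fun s _ => hdiv s) hv hr' ht' y,
        fun y => det_fderiv_evolutionMap_slab (by linarith) h1 (fun s _ => hdiv s) hv ht' hr' y⟩
    · have ht' : t ∈ Icc (r - ε) r := ⟨by linarith [ht.1], htr.le⟩
      have hr' : r ∈ Icc (r - ε) r := ⟨by linarith, le_rfl⟩
      exact ⟨fun y => det_fderiv_evolutionMap_slab (by linarith) h2 (fun s _ => hdiv s) hv hr' ht' y,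
        fun y => det_fderiv_evolutionMap_slab (by linarith) h2 (fun s _ => hdiv s) hv ht' hr' y⟩

end Eulerian

section Level

variable {k : ℕ}

/-- The Eulerian level field is divergence free at every time. [folklore] -/
theorem isDivFree_level (D : FractalCarrierData k) (m : ℕ) (t : ℝ) : IsDivFree (D.level m t) := by
  rw [Summit.AnomalousDissipation.AnomalousDissipation.Theorems.SolenoidalFractalHomogenisation.PermissibleCarrier.level_eq_smul]
  set G : UnitAddTorus (Fin 3) → EuclideanSpace ℝ (Fin 3) := fun x => (D.word m).carrier (D.a m * t) (D.N m • x) with hG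
  have hGd : IsDivFree G :=
    Summit.AnomalousDissipation.AnomalousDissipation.Theorems.SolenoidalFractalHomogenisation.PermissibleCarrier.isDivFree_layerComb
      (D.word m) _ (D.N m)
  have hGs : IsSmooth G :=
    Summit.AnomalousDissipation.AnomalousDissipation.Theorems.SolenoidalFractalHomogenisation.PermissibleCarrier.isSmooth_carrier_nsmul
      (D.word m) _ (D.N m)
  intro x
  have h1 : IsContDiff 1 G := hGs.isContDiff (by simp)
  unfold divergence
  have e : ∀ i : Fin 3, Torus.partialDeriv i (fun y => ((D.a m / (D.N m : ℝ)) • G) y i) x =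
      (D.a m / (D.N m : ℝ)) * Torus.partialDeriv i (fun y => G y i) x := by
    intro i
    have hGi : IsContDiff 1 (fun y => G y i) := (EuclideanSpace.proj i : EuclideanSpace ℝ (Fin 3) →L[ℝ] ℝ).contDiff.comp h1
    have h : (fun y => ((D.a m / (D.N m : ℝ)) • G) y i) = (D.a m / (D.N m : ℝ)) • fun y => G y i := by
      funext y; simp
    rw [h, Torus.partialDeriv_const_smul hGi]
    rfl
  simp only [e, ← Finset.mul_sum]
  have := hGd x
  unfold divergence at this
  rw [this, mul_zero]

/-- The Eulerian level field is jointly smooth on one-sided time slabs around every time (the `IsSmoothSpaceTimeOn` form of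
`…LevelField.exists_contDiffOn_slabs_level_proj`). [folklore] -/
theorem exists_isSmoothSpaceTimeOn_slabs_level (D : FractalCarrierData k) (m : ℕ) (r : ℝ) :
    ∃ ε > 0, IsSmoothSpaceTimeOn (Icc r (r + ε)) (D.level m) ∧ IsSmoothSpaceTimeOn (Icc (r - ε) r) (D.level m) :=
  exists_contDiffOn_slabs_level_proj D m r

/-- **Liouville for the Eulerian levels**: every evolution map of the lifted level field has Jacobian determinant `1`. [folklore] -/
theorem det_fderiv_evolutionMap_level (D : FractalCarrierData k) (m : ℕ) (s t : ℝ) (y : EuclideanSpace ℝ (Fin 3)) :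
    (fderiv ℝ (evolutionMap (fun t (z : EuclideanSpace ℝ (Fin 3)) => D.level m t (proj z)) s t) y).det = 1 :=
  det_fderiv_evolutionMap_of_local (exists_isSmoothSpaceTimeOn_slabs_level D m) (isDivFree_level D m)
    (isUniformlyLipschitzOn_level_proj D m) s t y

end Level

end Summit.AnomalousDissipation.AnomalousDissipation.Theorems.SolenoidalFractalHomogenisation.LagrangianCarrierConstruction

end
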